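import Mathlib

/-!
# Limits of subspaces of bounded-below dimension

An elementary compactness-of-the-Grassmannian statement: from a sequence of subspaces
`K k` of a finite-dimensional complex inner product space, each of dimension at least `d`,
one extracts a subsequence `ψ` and a subspace `W` of dimension at least `d` such that every
vector of `W` is a limit of vectors taken from the subspaces `K (ψ i)`.
-/

set_option linter.dupNamespace false

noncomputable section

open Filter Topology

namespace Summit.ValiantsHypothesis.ValiantsHypothesis.Theorems.RefutationDegree

/-- **Compactness of the Grassmannian, elementary form.** If every subspace `K k` of a
finite-dimensional complex inner product space has dimension at least `d`, then along some
subsequence `ψ` there is a subspace `W` of dimension at least `d` all of whose vectors are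
limits of vectors `v i ∈ K (ψ i)`. -/
theorem stub_exists_submodule_limit {E : Type*} [NormedAddCommGroup E] [InnerProductSpace ℂ E]
    [FiniteDimensional ℂ E] (d : ℕ) (K : ℕ → Submodule ℂ E)
    (hK : ∀ k, d ≤ Module.finrank ℂ (K k)) :
    ∃ (W : Submodule ℂ E) (ψ : ℕ → ℕ), StrictMono ψ ∧ d ≤ Module.finrank ℂ W ∧
      ∀ w ∈ W, ∃ v : ℕ → E, (∀ i, v i ∈ K (ψ i)) ∧ Tendsto v atTop (𝓝 w) := by
  haveI : ProperSpace E := FiniteDimensional.proper_rclike ℂ E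
  -- An orthonormal `d`-frame inside each `K k`.
  let b : ℕ → Fin d → E := fun k i =>
    ((stdOrthonormalBasis ℂ (K k)) (Fin.castLE (hK k) i) : E)
  have hb_orth : ∀ k, Orthonormal ℂ (b k) := fun k =>
    (((stdOrthonormalBasis ℂ (K k)).orthonormal.comp _
      (Fin.castLE_injective (hK k))).comp_linearIsometry (K k).subtypeₗᵢ)
  have hb_mem : ∀ k i, b k i ∈ K k := fun k i => Submodule.coe_mem _
  -- The frames form a bounded sequence in the proper space `Fin d → E`.
  have hb_bdd : ∀ k, b k ∈ Metric.closedBall (0 : Fin d → E) 1 := by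
    intro k
    rw [Metric.mem_closedBall, dist_zero_right]
    exact (pi_norm_le_iff_of_nonneg zero_le_one).mpr fun i => ((hb_orth k).norm_eq_one i).le
  obtain ⟨c, -, ψ, hψ, hlim⟩ := tendsto_subseq_of_bounded Metric.isBounded_closedBall hb_bdd
  have hlim_i : ∀ i, Tendsto (fun j => b (ψ j) i) atTop (𝓝 (c i)) := fun i =>
    tendsto_pi_nhds.mp hlim i
  -- The limit frame is orthonormal.
  have hc_orth : Orthonormal ℂ c := by
    classical
    rw [orthonormal_iff_ite]
    intro i j
    have h1 : Tendsto (fun n => inner ℂ (b (ψ n) i) (b (ψ n) j)) atTop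
        (𝓝 (inner ℂ (c i) (c j))) :=
      (hlim_i i).inner (hlim_i j)
    have h2 : (fun n => inner ℂ (b (ψ n) i) (b (ψ n) j)) =
        fun _ => if i = j then (1 : ℂ) else 0 := by
      funext n
      exact (orthonormal_iff_ite.mp (hb_orth (ψ n))) i j
    rw [h2] at h1
    exact tendsto_nhds_unique h1 tendsto_const_nhds
  refine ⟨Submodule.span ℂ (Set.range c), ψ, hψ, ?_, ?_⟩
  · rw [finrank_span_eq_card hc_orth.linearIndependent, Fintype.card_fin]
  · intro w hw
    obtain ⟨a, rfl⟩ := (Submodule.mem_span_range_iff_exists_fun ℂ).mp hw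
    refine ⟨fun j => ∑ i, a i • b (ψ j) i, fun j => ?_, ?_⟩
    · exact Submodule.sum_mem _ fun i _ => Submodule.smul_mem _ _ (hb_mem _ _)
    · exact tendsto_finsetSum _ fun i _ => (hlim_i i).const_smul (a i)

end Summit.ValiantsHypothesis.ValiantsHypothesis.Theorems.RefutationDegree

end
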